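import Summits.HodgeConjecture.HodgeConjecture.Theorems.PadicSemiregularLiftFormalVectorBundlesAlgebraizeModuleBockstein
import Summits.HodgeConjecture.HodgeConjecture.Theorems.PadicSemiregularLiftFormalVectorBundlesAlgebraizeThickenings
import Literature.AlgebraicGeometry.Resolution.FiniteOverCompleteLocal
import Literature.AlgebraicGeometry.Morphisms.CechModuleUnit
import Literature.AlgebraicGeometry.Modules.SheafHomFunctor
import Literature.AlgebraicGeometry.Modules.LocalFrames
import Literature.AlgebraicGeometry.KTheory.PullbackVectorBundle
import Mathlib.RingTheory.WittVector.Complete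

/-!
# `p`-regularity of vector bundles on `W(k)`-flat schemes; `p`-adic completeness of `Hom(V', V)`

Helper file for stub `stub_presentationAlgebraize` (EB2) of line `chow-zariski-pushforward` of the
crux `PadicSemiregularLift.FormalVectorBundlesAlgebraize` (`stmt-HodgeConjecture-14106`): the limit step
of the algebraization of a compatible family of morphisms of vector bundles on the `p`-adic tower of a
proper `W(k)`-scheme `Z`.

* `mono_globalScalar_of_forall_mul_eq_zero`, `mono_globalScalar_p` — a global function which is a
  non-zero-divisor on every `Γ(Z, U)` acts injectively on a finite locally free module (expand in local
  frames, tree `Modules/LocalFrames`); in particular `p` on a `W(k)`-FLAT `Z`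
  (`mul_p_injective_sections` of `…AlgebraizeThickenings`) — the regularity hypothesis of the module
  Bockstein lemma for `𝓗om(V', V)`;
* `moduleFinite_sections_of_isVectorBundle` — `Γ(Z, M)` is a finite `A`-module for a vector bundle `M` on
  a proper `A`-scheme, `A` Noetherian (dévissage `Devissage.devissage` + `DevissageHeart.heart_holds`,
  `coh_of_isVectorBundle` of `…AlgebraizeModuleBockstein`, `Ȟ⁰ = Γ`);
* `overFunctor_top_map_bijective` — `Hom(V', N) = Γ(Z, 𝓗om(V', N))` (restriction to the opens over `⊤`);
* `exists_limit_hom` — **`Hom(V', V)` is `p`-adically complete** when `𝓗om(V', V)` is a vector bundle on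
  the proper `Z`: finite over the `p`-adically complete Noetherian `W(k)` (Mathlib
  `WittVector.isAdicCompleteIdealSpanP`), hence complete (tree `Resolution.isAdicComplete_of_finite`,
  Mathlib `IsPrecomplete`); stated for sequences `w_n` with `w_{n+1} - w_n ∈ p^{n+1} Hom(V', V)`.

Everything is proved; no definitions.
-/

set_option linter.dupNamespace false

noncomputable section

-- Summit.HodgeConjecture.HodgeConjecture.… repeats the summit name by the D-0017 layout (Sub = Summit).

open CategoryTheory CategoryTheory.Limits

universe u

namespace Summit.HodgeConjecture.HodgeConjecture.Theorems.FormalVectorBundlesAlgebraize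

/-! ### Regular global scalars on finite locally free modules -/

section Regular

open AlgebraicGeometry TopologicalSpace Opposite Literature.AlgebraicGeometry.Motives
  Literature.AlgebraicGeometry.Modules

variable {X : Scheme.{u}} {M : X.Modules}

/-- **A global function which is a non-zero-divisor on all `Γ(X, U)` acts injectively on the sections
of a finite locally free module** (expand in a local frame: the coordinates of `a • x` are `a` times
those of `x`). -/
theorem mono_globalScalar_of_forall_mul_eq_zero (hM : IsFiniteLocallyFree M) (a : Γ(X, ⊤))
    (ha : ∀ (U : X.Opens) (x : Γ(X, U)), X.presheaf.map (homOfLE (le_top : U ≤ ⊤)).op a * x = 0 → x = 0) :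
    Mono (globalScalar M a) := by
  classical
  refine Literature.AlgebraicGeometry.KTheory.mono_of_app_injective _ fun U => ?_
  rw [injective_iff_map_eq_zero]
  intro x hx
  rw [globalScalar_app_apply] at hx
  -- check `x = 0` locally, on trivialising opens
  choose W₀ hzW₀ I hI e using fun z : X => hM z
  let O : U → X.Opens := fun z => U ⊓ W₀ z.1
  have hO : ∀ z : U, O z ≤ U := fun z => inf_le_left
  have hcov : U ≤ iSup O := fun z hz => Opens.mem_iSup.mpr ⟨⟨z, hz⟩, hz, hzW₀ z⟩
  refine TopCat.Sheaf.eq_of_locally_eq' (⟨M.presheaf, M.isSheaf⟩ : TopCat.Sheaf Ab X) O U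
    (fun z => homOfLE (hO z)) hcov x 0 fun z => ?_
  rw [map_zero]
  change M.presheaf.map (homOfLE (hO z)).op x = 0
  haveI := Fintype.ofFinite (I z.1)
  let eO := SheafOfModules.restrictTrivialisation (R := X.ringCatSheaf) (homOfLE (inf_le_right : O z ≤ W₀ z.1)) (e z.1).some
  set xO := M.presheaf.map (homOfLE (hO z)).op x
  have haO : X.presheaf.map (homOfLE (le_top : O z ≤ ⊤)).op a • xO = 0 := by
    have h := congrArg (M.presheaf.map (homOfLE (hO z)).op) hx
    rw [map_zero, Scheme.Modules.map_smul] at h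
    rw [← h]
    congr 1
    change _ = (X.presheaf.map _ ≫ X.presheaf.map _) a
    rw [← Functor.map_comp]
    rfl
  -- all coordinates of `xO` vanish
  have hcoord : ∀ i, coord eO (𝟙 _) xO i = 0 := by
    intro i
    apply ha (O z)
    have h := congrArg (fun s => coord eO (𝟙 _) s i) haO
    simp only at h
    rw [coord_def, coord_def, appLE_smul_right, appLE_zero_right] at h
    exact h
  rw [eq_sum_coord_smul eO (𝟙 _) xO]
  exact Finset.sum_eq_zero fun i _ => by rw [hcoord, zero_smul]

end Regular

section RegularWitt

open AlgebraicGeometry TopologicalSpace Opposite Literature.AlgebraicGeometry.Motives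
  Literature.AlgebraicGeometry.Motives.WittScheme Literature.AlgebraicGeometry.Modules

variable {p : ℕ} [Fact p.Prime] {k : Type u} [Field k] [CharP k p] (Z : SchemeOver (WittVector p k))

/-- **`p` is regular on every finite locally free module on a `W(k)`-flat scheme `Z`.** -/
theorem mono_globalScalar_p [Flat Z.hom] {M : Z.left.Modules} (hM : IsFiniteLocallyFree M) :
    Mono (globalScalar M (Literature.AlgebraicGeometry.Morphisms.algebraMapΓ Z.hom (p : WittVector p k))) := by
  refine mono_globalScalar_of_forall_mul_eq_zero hM _ fun U x hx => mul_p_injective_sections Z U x ?_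
  rwa [map_natCast, map_natCast] at hx

end RegularWitt

/-! ### `Hom(V', V)` is a finite `W`-module for `Z` proper, hence `p`-adically complete -/

section Complete

open AlgebraicGeometry TopologicalSpace Opposite Literature.AlgebraicGeometry.Motives
  Literature.AlgebraicGeometry.Modules Literature.AlgebraicGeometry.Morphisms

/-- **Finiteness of `H⁰` of a vector bundle on a proper scheme over a Noetherian ring** (dévissage:
`Devissage.devissage` with `DevissageHeart.heart_holds`, `coh_of_isVectorBundle`). -/
theorem moduleFinite_sections_of_isVectorBundle {A : Type u} [CommRing A] [IsNoetherianRing A]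
    {X : Scheme.{u}} (f : X ⟶ Spec (.of A)) [IsProper f] {M : X.Modules} (hM : IsVectorBundle M) :
    Module.Finite A (MSections f M ⊤) := by
  classical
  haveI : IsLocallyNoetherian X := LocallyOfFiniteType.isLocallyNoetherian f
  haveI : CompactSpace X := QuasiCompact.compactSpace_of_compactSpace f
  obtain ⟨T, hT⟩ := exists_finite_affineOpens_iSup_eq_top (X := X)
  have hK := devissage (f := f) (U := fun V : T => ((V : X.affineOpens) : X.Opens)) (fun V => V.1.2)
    (heart_holds f (fun V => V.1.2) hT) M (coh_of_isVectorBundle hM)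
  have h0 := hK.finite_H0
  rwa [moduleFinite_cechMH0_iff f _ _ hT] at h0

variable {X : Scheme.{u}} {V' V : X.Modules}

/-- **Global sections of `𝓗om(V', N)` are the morphisms `V' ⟶ N`**: restriction to the opens over
`⊤`, `(V' ⟶ N) → (V'|_⊤ ⟶ N|_⊤) = Γ(𝓗om(V', N), ⊤)`, is bijective. -/
theorem overFunctor_top_map_bijective (V' N : X.Modules) :
    Function.Bijective fun s : V' ⟶ N => (Scheme.Modules.overFunctor (⊤ : X.Opens)).map s := by
  constructor
  · intro φ ψ h
    refine Scheme.Modules.hom_ext _ _ fun U => ?_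
    ext x
    change appLE ((SheafOfModules.overFunctor _ ⊤).map φ) (homOfLE le_top : U ⟶ ⊤) x =
      appLE ((SheafOfModules.overFunctor _ ⊤).map ψ) (homOfLE le_top : U ⟶ ⊤) x
    exact congrArg (fun χ => appLE χ (homOfLE le_top : U ⟶ ⊤) x) h
  · intro χ
    let φ : V' ⟶ N :=
      { val := PresheafOfModules.homMk
          { app := fun U => AddCommGrpCat.ofHom
              { toFun := fun s : Γ(V', U.unop) => (appLE χ (homOfLE le_top) s : Γ(N, U.unop))
                map_zero' := appLE_zero_right _ _
                map_add' := fun s s' => appLE_add_right χ _ s s' }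
            naturality := fun {U U'} i => by
              ext s
              change appLE χ (homOfLE le_top) (V'.presheaf.map i s) =
                N.presheaf.map i (appLE χ (homOfLE le_top) s)
              rw [show i = i.unop.op from rfl, ← appLE_map χ (homOfLE le_top) i.unop s]
              exact appLE_congr_hom χ _ _ _ }
          (fun U (r : Γ(X, U.unop)) (s : Γ(V', U.unop)) => appLE_smul_right χ _ r s) }
    refine ⟨φ, hom_ext_of_appLE fun W k s => ?_⟩
    change φ.app W s = appLE χ k s
    exact appLE_congr_hom χ _ _ _

/-- Restriction to the opens over `⊤` commutes with composition, on elements. -/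
theorem overFunctor_top_map_comp {V' N N' : X.Modules} (s : V' ⟶ N) (g : N ⟶ N') :
    (Scheme.Modules.overFunctor (⊤ : X.Opens)).map (s ≫ g) =
      (Scheme.Modules.overFunctor (⊤ : X.Opens)).map s ≫ (Scheme.Modules.overFunctor (⊤ : X.Opens)).map g :=
  Functor.map_comp _ _ _

/-- Restriction to the opens over `⊤` is additive. -/
theorem overFunctor_top_map_add (s s' : V' ⟶ V) :
    (Scheme.Modules.overFunctor (⊤ : X.Opens)).map (s + s') =
      (Scheme.Modules.overFunctor (⊤ : X.Opens)).map s + (Scheme.Modules.overFunctor (⊤ : X.Opens)).map s' :=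
  hom_ext_of_appLE fun _ _ _ => rfl

variable {p : ℕ} [Fact p.Prime] {k : Type u} [Field k] [CharP k p] [PerfectRing k p]
  (Z : SchemeOver (WittVector p k)) [IsProper Z.hom] {V' V : Z.left.Modules}

omit [CharP k p] [PerfectRing k p] [IsProper Z.hom] in
/-- The `W(k)`-scalar `p^n` acts on global sections of an `𝒪_Z`-module as the natural number `p^n`. -/
theorem pow_smul_msections (M : Z.left.Modules) (n : ℕ) (x : MSections Z.hom M ⊤) :
    ((p : WittVector p k) ^ n) • x = (p ^ n) • x := by
  rw [← MSections.algebraMap_smul, map_pow, map_natCast, ← Nat.cast_pow]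
  exact Nat.cast_smul_eq_nsmul _ (p ^ n) x

/-- **`Hom(V', V)` is `p`-adically complete** for `𝓗om(V', V)` a vector bundle on the proper
`W(k)`-scheme `Z`: a sequence `w_n : V' ⟶ V` with `w_{n+1} - w_n ∈ p^{n+1} Hom(V', V)` has a limit
`w` with `w - w_n ∈ p^{n+1} Hom(V', V)` for all `n` (`Γ(Z, 𝓗om(V', V)) = Hom(V', V)` is a finite
`W(k)`-module by dévissage, hence `p`-adically complete, `Resolution.isAdicComplete_of_finite`). -/
theorem exists_limit_hom (hM : IsVectorBundle (sheafHom V' V)) (w : ℕ → (V' ⟶ V))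
    (hw : ∀ n, ∃ y : V' ⟶ V, w (n + 1) - w n = (p ^ (n + 1)) • y) :
    ∃ wlim : V' ⟶ V, ∀ n, ∃ z : V' ⟶ V, wlim - w n = (p ^ (n + 1)) • z := by
  classical
  -- `Hom(V', V) → Γ(Z, 𝓗om(V', V))`, an additive bijection
  let τ : (V' ⟶ V) →+ MSections Z.hom (sheafHom V' V) ⊤ :=
    { toFun := fun s => (show Γ(sheafHom V' V, ⊤) from (Scheme.Modules.overFunctor (⊤ : Z.left.Opens)).map s)
      map_zero' := by
        have h := overFunctor_top_map_add (0 : V' ⟶ V) 0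
        rw [add_zero] at h
        exact left_eq_add.mp h
      map_add' := fun s s' => overFunctor_top_map_add s s' }
  have hτ : Function.Bijective τ := overFunctor_top_map_bijective V' V
  -- the Cauchy sequence
  let f : ℕ → MSections Z.hom (sheafHom V' V) ⊤ := fun n => τ (w n)
  have hstep : ∀ n, f (n + 1) - f n ∈
      (Ideal.span {(p : WittVector p k)} ^ (n + 1) • ⊤ : Submodule (WittVector p k) (MSections Z.hom (sheafHom V' V) ⊤)) := by
    intro n
    obtain ⟨y, hy⟩ := hw n
    have h : f (n + 1) - f n = ((p : WittVector p k) ^ (n + 1)) • τ y := by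
      simp only [f]
      rw [← map_sub, hy, map_nsmul, pow_smul_msections]
    rw [h]
    exact Submodule.smul_mem_smul (Ideal.pow_mem_pow (Ideal.mem_span_singleton_self _) _) Submodule.mem_top
  have hcauchy : ∀ {m n : ℕ}, m ≤ n → f m ≡ f n
      [SMOD (Ideal.span {(p : WittVector p k)} ^ m • ⊤ : Submodule (WittVector p k) (MSections Z.hom (sheafHom V' V) ⊤))] := by
    intro m n hmn
    induction n, hmn using Nat.le_induction with
    | base => exact SModEq.rfl
    | succ n hmn ih =>
      refine ih.trans ?_
      rw [SModEq.sub_mem, ← neg_sub]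
      exact Submodule.neg_mem _ (Submodule.smul_mono_left (Ideal.pow_le_pow_right (by omega)) (hstep n))
  haveI : Module.Finite (WittVector p k) (MSections Z.hom (sheafHom V' V) ⊤) :=
    moduleFinite_sections_of_isVectorBundle Z.hom hM
  haveI : IsAdicComplete (Ideal.span {(p : WittVector p k)}) (MSections Z.hom (sheafHom V' V) ⊤) :=
    Literature.AlgebraicGeometry.Resolution.isAdicComplete_of_finite _ _
  obtain ⟨L, hL⟩ := IsPrecomplete.prec' f hcauchy
  obtain ⟨wlim, hwlim⟩ := hτ.2 L
  refine ⟨wlim, fun n => ?_⟩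
  -- `L - f n ∈ I^{n+1} S = p^{n+1} S`
  have h1 : L - f n ∈
      (Ideal.span {(p : WittVector p k)} ^ (n + 1) • ⊤ : Submodule (WittVector p k) (MSections Z.hom (sheafHom V' V) ⊤)) := by
    have h2 : f (n + 1) - L ∈ (Ideal.span {(p : WittVector p k)} ^ (n + 1) • ⊤ :
        Submodule (WittVector p k) (MSections Z.hom (sheafHom V' V) ⊤)) := (SModEq.sub_mem).mp (hL (n + 1))
    have h3 := Submodule.sub_mem _ (hstep n) h2
    rwa [sub_sub_sub_cancel_left] at h3
  rw [Ideal.span_singleton_pow, Submodule.ideal_span_singleton_smul] at h1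
  obtain ⟨zz, -, hzz⟩ := (Submodule.mem_smul_pointwise_iff_exists _ _ _).mp h1
  obtain ⟨z, rfl⟩ := hτ.2 zz
  refine ⟨z, hτ.1 ?_⟩
  rw [map_sub, hwlim, map_nsmul, ← pow_smul_msections, hzz]

end Complete

section Stub

open AlgebraicGeometry

/-- **Registered sub-goal** (helper stub of `stub_presentationAlgebraize`, universe `0`): `p`-adic
completeness of `Hom(V', V)` for `𝓗om(V', V)` a vector bundle on a proper `W(k)`-scheme
(`exists_limit_hom`). -/
theorem stub_homCompleteness :
    ∀ (p : ℕ) [Fact p.Prime] (k : Type) [Field k] [CharP k p] [PerfectRing k p] (Z : Literature.AlgebraicGeometry.Motives.SchemeOver (WittVector p k)) [AlgebraicGeometry.IsProper Z.hom] (V' V : Z.left.Modules), Literature.AlgebraicGeometry.Motives.IsVectorBundle (Literature.AlgebraicGeometry.Modules.sheafHom V' V) → ∀ (w : ℕ → (V' ⟶ V)), (∀ n : ℕ, ∃ y : V' ⟶ V, w (n + 1) - w n = (p ^ (n + 1)) • y) → ∃ wlim : V' ⟶ V, ∀ n : ℕ, ∃ z : V' ⟶ V, wlim - w n = (p ^ (n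 + 1)) • z :=
  fun _ _ _ _ _ _ Z _ _ _ hM w hw => exists_limit_hom Z hM w hw

end Stub

end Summit.HodgeConjecture.HodgeConjecture.Theorems.FormalVectorBundlesAlgebraize

end
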